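import Literature.MathematicalPhysics.QuantumFieldTheory.OSAxiomsFreeFieldKernelProofs
import Literature.MathematicalPhysics.QuantumFieldTheory.GaussianFieldOfCovariance
import Literature.MathematicalPhysics.QuantumLattice.EuclideanAction
import HarnessLib

/-!
# The mass of the Euclidean Proca field: kernel bounds and the exact decay of correlations (Chatterjee, Lemmas 4.1, 4.7, 2.6)

S. Chatterjee, *A scaling limit of `SU(2)` lattice Yang–Mills–Higgs theory*, Probab. Math. Phys.
**7** (2026) 339–381, arXiv:2401.10507 [Chatterjee2026YMHiggs], §2.2 (the kernel `K_λ`, (2.1)),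
§2.4 (**Lemma 2.6**: "the Euclidean Proca field with parameter `λ` has mass `√λ`"), §4.1
(**Lemma 4.1**: pointwise bound on `K_λ`), §4.5 (**Lemma 4.7**: exact asymptotics of `K_λ`;
proof of Lemma 2.6); arXiv:2401.10507v4 numbering. This is the "mass generation" content of the
paper's main theorems (Thm 3.1/3.2: the scaling limits are Proca fields of mass `c`, `c/√2`;
tree: `Chatterjee2026YMHiggs.chatterjee_u1_higgs`, `ContinuumLimits.chatterjee_su2_higgs`):
exponential decay of correlations of the LIMIT field at the exact rate `√λ`, with the prefactor.
Statements only (cross-ladder literature-typing layer, D-0088): three named facts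
`def … : Prop` (D-0014), each proved in the source by elementary analysis.

## Vocabulary (all from the tree)

* The kernel `K_λ(x) = ∫₀^∞ (4πt)^{−d/2} exp (−‖x‖²/(4t) − λt) dt` of (2.1) is, with `λ = m²`,
  the free propagator kernel `K_m(x) = ∫₀^∞ e^{−m²t} p_t(x) dt` of the tree, written out — as in
  `OSAxiomsFreeFieldKernelProofs`, which introduces no definition for it — as the Bochner integral
  `∫ t in Ioi 0, Real.exp (-m ^ 2 * t) * heatKernel t x` (`heatKernel t x = (4πt)^{−d/2}
  e^{−‖x‖²/(4t)}`, `d = finrank ℝ E`); there `𝓕 K_m = ((2π‖ξ‖)² + m²)⁻¹ = freeSymbol m`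
  (`fourier_freeKernel`) and `K_m ⋆ φ = C_m φ` (`freeKernel_convolution_eq`), so Chatterjee's
  operator `K_λ` on `𝒮` (Lemma 2.1: `K_λ⁻¹ = −Δ + λ`) is the tree's `freeCovarianceOp m`, and
  `∫ f K_λ g = freeCovarianceReal m f g`.
* The Proca covariance on the test 1-forms `φ v`, `ψ v` of one direction `v`:
  `(φ v, R_λ ψ v) = ‖v‖² ∫ φ K_λ ψ + λ⁻¹ ∫ (∂_v φ) K_λ (∂_v ψ)` (§4.5, last display of the proof of
  Lemma 2.6) `= procaComponentCovariance m v φ ψ` (`GaussianFieldOfCovariance`), which is the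
  covariance `Cov(X(φ v), X(ψ v))` of the Proca field (§4.5: `Cov(X(f), X(g)) = (f, R_λ g)` by
  polarisation and self-adjointness of `R_λ`).
* Translates `g^x(y) = g(x + y)` (§2.4) are `translateTest (−x) g` (`EuclideanAction`:
  `translateTest a f y = f (y − a)`).

## Contents

* `kernelK_upperBound` (**Lemma 4.1**): `K_λ(x) ≤ C(d) e^{−‖x‖√λ/2} ‖x‖^{−(d−2)}` (`d ≥ 3`), and
  the two `d = 2` bounds.
* `kernelK_asymptotics` (**Lemma 4.7**):
  `K_λ(x) ∼ λ^{(d−3)/4} e^{−√λ‖x‖} / (2 (2π)^{(d−1)/2} ‖x‖^{(d−1)/2})` as `‖x‖ → ∞`.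
* `massProfile m u f g = ∫∫ f(y) g(y − w) e^{−√λ u·w} dw dy` (the `I(f, g, u, λ)` of §2.4) and
  `procaComponent_correlationDecay` (**Lemma 2.6**, component form): for bump functions `φ, ψ`,
  `‖x_n‖ → ∞`, `x_n/‖x_n‖ → u`,
  `Cov(X(φv), X((ψv)^{x_n})) ‖x_n‖^{(d−1)/2} e^{√λ‖x_n‖} → λ^{(d−3)/4}/(2(2π)^{(d−1)/2}) ·
  (‖v‖² I(φ, ψ, u, λ) + λ⁻¹ I(∂_vφ, ∂_vψ, u, λ))`.

Deviation from print: Lemma 2.6 is stated for general bump 1-forms `f, g ∈ 𝒜(ℝᵈ)` with the sums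
`∑ᵢ I(fᵢ, gᵢ) + λ⁻¹ ∑ᵢⱼ I(∂ᵢfᵢ, ∂ⱼgⱼ)`; transcribed here for `f = φ v`, `g = ψ v` (one direction,
as everywhere in the tree's rendering of this paper: `∑ᵢ fᵢ gᵢ`-terms give `‖v‖² I(φ, ψ)`,
`∑ᵢ ∂ᵢfᵢ = ∂_vφ`), over any finite-dimensional real inner product space `E` of dimension `d ≥ 2`
(the paper's `ℝᵈ`, `d ≥ 2`), with `√λ = m > 0`. Not transcribed: Lemmas 2.1–2.2, 4.2–4.3 (the
operator identities `K_λ⁻¹ = −Δ + λ`, `R_λ⁻¹ = Q_λ` on `𝒮` — in the tree `C_m` is the Fourier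
multiplier by definition), Lemma 2.5 (scaling `a^{(d−2)/2} X(ax + b)` is Proca with parameter
`a²λ`: dilations of `𝓢` are not in the vocabulary), Cor 4.8 and Lemma 4.9 (steps of the proof).
-/

noncomputable section

open scoped SchwartzMap RealInnerProductSpace LineDeriv
open MeasureTheory Filter Topology Set Bornology
open Literature.MathematicalPhysics.QuantumLattice Literature.Analysis.UnboundedOperators

namespace Literature.MathematicalPhysics.QuantumFieldTheory.Chatterjee2026YMHiggs

variable (E : Type*) [NormedAddCommGroup E] [InnerProductSpace ℝ E] [FiniteDimensional ℝ E]
  [MeasurableSpace E] [BorelSpace E]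

/-! ### Lemma 4.1: a pointwise upper bound for `K_λ` -/

/-- **Lemma 4.1** (pointwise bound on the kernel `K_λ` of (2.1); named fact, D-0014 — proved in the
source by the substitution `s = ‖x‖²/(4t)` and AM–GM). *Printed:* "The function `K_λ` satisfies
the bound `K_λ(x) ≤ C(d) e^{−‖x‖√λ/2} ‖x‖^{−(d−2)}` if `d ≥ 3`;
`≤ C(d) e^{−‖x‖√λ/4} (1 + λ⁻¹)` if `d = 2` and `‖x‖ ≥ 2√λ`;
`≤ C(d) e^{−‖x‖√λ/4} (λ⁻¹ + log(2√λ/‖x‖))` if `d = 2` and `‖x‖ < 2√λ`, for all `x ∈ ℝᵈ ∖ {0}`,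
where `C(d)` is a constant that depends only on `d`." *Rendered* over a finite-dimensional real
inner product space `E` of dimension `d`, with `√λ = m > 0` and
`K_λ(x) = ∫ t in Ioi 0, e^{−m²t} heatKernel t x` (module docstring): there is `C` (depending on
`E` only through `d`) such that the three bounds hold for every `m > 0` and `x ≠ 0`.
[cite: Chatterjee2026YMHiggs, Lemma 4.1 (§4.1); proof ibid.] -/
def kernelK_upperBound : Prop :=
  ∃ C : ℝ, ∀ (m : ℝ), 0 < m → ∀ x : E, x ≠ 0 →
    (3 ≤ Module.finrank ℝ E →
      ∫ t in Ioi (0 : ℝ), Real.exp (-m ^ 2 * t) * heatKernel t x ≤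
        C * Real.exp (-(‖x‖ * m / 2)) * ‖x‖ ^ (-((Module.finrank ℝ E : ℝ) - 2))) ∧
    (Module.finrank ℝ E = 2 → 2 * m ≤ ‖x‖ →
      ∫ t in Ioi (0 : ℝ), Real.exp (-m ^ 2 * t) * heatKernel t x ≤
        C * Real.exp (-(‖x‖ * m / 4)) * (1 + (m ^ 2)⁻¹)) ∧
    (Module.finrank ℝ E = 2 → ‖x‖ < 2 * m →
      ∫ t in Ioi (0 : ℝ), Real.exp (-m ^ 2 * t) * heatKernel t x ≤
        C * Real.exp (-(‖x‖ * m / 4)) * ((m ^ 2)⁻¹ + Real.log (2 * m / ‖x‖)))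

/-! ### Lemma 4.7: the exact asymptotics of `K_λ` -/

/-- **Lemma 4.7** (asymptotics of the kernel; named fact, D-0014 — proved in the source by
completing the square `‖x‖²/(4t) + λt = (‖x‖ − 2√λ t)²/(4t) + √λ‖x‖` and Laplace's method).
*Printed:* "As `‖x‖ → ∞`, `K_λ(x) ∼ λ^{(d−3)/4} e^{−√λ‖x‖} / (2 (2π)^{(d−1)/2} ‖x‖^{(d−1)/2})`,
meaning that the ratio of the two sides tends to `1` as `‖x‖ → ∞`." *Rendered* with `√λ = m > 0`
(so `λ^{(d−3)/4} = m^{(d−3)/2}`), `d = finrank ℝ E ≥ 2` (the paper's standing `d ≥ 2`), along the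
cobounded filter of `E` (`‖x‖ → ∞`). In particular the free covariance kernel `K_m` of the tree
decays exactly at rate `m` (Glimm–Jaffe Prop. 7.2.1 gives the rate; this is the sharp constant).
[cite: Chatterjee2026YMHiggs, Lemma 4.7 (§4.5); proof ibid.] -/
def kernelK_asymptotics : Prop :=
  2 ≤ Module.finrank ℝ E → ∀ (m : ℝ), 0 < m →
    Tendsto
      (fun x : E =>
        (∫ t in Ioi (0 : ℝ), Real.exp (-m ^ 2 * t) * heatKernel t x) /
          (m ^ (((Module.finrank ℝ E : ℝ) - 3) / 2) * Real.exp (-(m * ‖x‖)) /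
            (2 * (2 * Real.pi) ^ (((Module.finrank ℝ E : ℝ) - 1) / 2) *
              ‖x‖ ^ (((Module.finrank ℝ E : ℝ) - 1) / 2))))
      (cobounded E) (𝓝 1)

/-! ### Lemma 2.6: the mass of the Euclidean Proca field -/

variable {E} in
/-- The directional profile `I(f, g, u, λ) := ∫∫ f(y) g(y − w) e^{−√λ u·w} dw dy` of §2.4 (the
display before Lemma 2.6), for two test functions, a unit vector `u` and `√λ = m`; the integrals
are over `E` (the paper's `ℝᵈ`). Bochner integrals: meaningful (absolutely convergent) for
compactly supported `f, g`, the only case in which it is used. [cite: Chatterjee2026YMHiggs, §2.4 (the display defining I(f, g, u, λ) before Lemma 2.6)] -/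
def massProfile (m : ℝ) (u : E) (f g : 𝓢(E, ℝ)) : ℝ :=
  ∫ y, ∫ w, f y * g (y - w) * Real.exp (-(m * ⟪u, w⟫))

/-- **Lemma 2.6** (the mass of the Euclidean Proca field is `√λ`; named fact, D-0014 — proved in
the source, §4.5, from Lemma 4.7 via Cor 4.8, Lemma 4.9 and `Cov(X(f), X(g^x)) = (f, R_λ g^x)
= ∑ᵢ ∫ fᵢ K_λ gᵢ^x + λ⁻¹ ∑ᵢⱼ ∫ (∂ᵢfᵢ) K_λ (∂ⱼgⱼ)^x`). *Printed:* "Let `X` be a Euclidean Proca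
field with parameter `λ`. Let `{x_n}` be a sequence in `ℝᵈ` such that `‖x_n‖ → ∞` and
`‖x_n‖⁻¹ x_n → u ∈ S^{d−1}`. Then for any two bump functions `f, g ∈ 𝒜(ℝᵈ)`,
`lim_n Cov(X(f) X(g^{x_n})) / (‖x_n‖^{−(d−1)/2} e^{−√λ‖x_n‖}) = λ^{(d−3)/4}/(2(2π)^{(d−1)/2}) ·
(∑ᵢ I(fᵢ, gᵢ, u, λ) + λ⁻¹ ∑ᵢⱼ I(∂ᵢfᵢ, ∂ⱼgⱼ, u, λ))`", `g^x(y) = g(x + y)`; "In particular, the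
Euclidean Proca field with parameter `λ` has mass `√λ`." *Rendered* (component form, module
docstring): `d = finrank ℝ E ≥ 2`, `√λ = m > 0`, a direction `v`, compactly supported test
functions `φ, ψ` (bump functions), `f = φ v`, `g = ψ v`, so that
`Cov(X(f), X(g^{x})) = procaComponentCovariance m v φ (translateTest (−x) ψ)` and the printed
right-hand side is `m^{(d−3)/2}/(2(2π)^{(d−1)/2}) (‖v‖² I(φ, ψ, u) + m⁻² I(∂_vφ, ∂_vψ, u))`
(`massProfile`). [cite: Chatterjee2026YMHiggs, Lemma 2.6 (§2.4); proof §4.5 (Lemma 4.7, Cor 4.8, Lemma 4.9)] -/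
def procaComponent_correlationDecay : Prop :=
  2 ≤ Module.finrank ℝ E → ∀ (m : ℝ), 0 < m → ∀ (v : E) (φ ψ : 𝓢(E, ℝ)),
    HasCompactSupport φ → HasCompactSupport ψ →
    ∀ (x : ℕ → E) (u : E), ‖u‖ = 1 →
      Tendsto (fun n => ‖x n‖) atTop atTop →
      Tendsto (fun n => ‖x n‖⁻¹ • x n) atTop (𝓝 u) →
      Tendsto
        (fun n =>
          procaComponentCovariance m v φ (translateTest (-(x n)) ψ) /
            (‖x n‖ ^ (-(((Module.finrank ℝ E : ℝ) - 1) / 2)) * Real.exp (-(m * ‖x n‖))))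
        atTop
        (𝓝 (m ^ (((Module.finrank ℝ E : ℝ) - 3) / 2) /
            (2 * (2 * Real.pi) ^ (((Module.finrank ℝ E : ℝ) - 1) / 2)) *
          (‖v‖ ^ 2 * massProfile m u φ ψ +
            (m ^ 2)⁻¹ * massProfile m u (∂_{v} φ) (∂_{v} ψ))))

end Literature.MathematicalPhysics.QuantumFieldTheory.Chatterjee2026YMHiggs
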